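import Literature.Computability.AlgebraicComplexity.ProjectedShiftedPartials
import Literature.Computability.AlgebraicComplexity.HomDepthFourNormalForm
import HarnessLib

/-!
# The upper bound on the projected shifted partials of a restricted homogeneous `ΣΠΣΠ` circuit
(Kumar–Saraf 2017, Lemma 4.1 with §3 and the deterministic part of Lemma 8.2)

Topic `Literature/Computability/AlgebraicComplexity`; third infrastructure file for the printed
proof of `kumarSaraf2017_imm_homDepthFour` (`HomogeneousDepthFour.lean`). It combines the
measure-side bound `KumarSaraf.pspDim_prod_le` (`ProjectedShiftedPartials.lean`) with the circuit
normal form `ArithCircuit.exists_sum_prod` and the restriction `restrictVars`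
(`HomDepthFourNormalForm.lean`):

* `KumarSaraf.chunkAux` / `KumarSaraf.exists_merge` — the merging step of the proof of Lemma 4.1
  ("we can assume that there is at most one `i` such that degree of `P_i` is less than `s/2`.
  Otherwise, we could multiply two such low degree `P_i` … Therefore, `l ≤ ⌈2u/s⌉`"): a list of
  factors of bottom support `≤ s` with total degree `≤ n` regroups into `≤ 2n/s + 1` factors of
  bottom support `≤ s` with the same product (greedy chunking of the low-degree factors; a chunk of
  total degree `< s` has bottom support `< s`).
* `KumarSaraf.suppLE_restrictVars_of_isBottomFactor` — under the event of Lemma 8.2 ("no bottom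
  product gate of support `> s` survives", here: every bottom monomial of `P` all of whose
  variables lie in `V` has support `≤ s`) every restricted bottom factor `Q_{ij}|_V` has bottom
  support `≤ s`, i.e. `C|_V` is a `ΣΠΣΠ^{{s}}` circuit.
* **`KumarSaraf.pspDim_restrict_le`** — for a homogeneous depth-4 circuit `P` computing `f`
  (homogeneous of degree `n ≥ 2`) and such a `V`:
  `Φ_{ℳ,m}(f|_V) ≤ size(P) · #{A ⊆ [2n/s+1] : |A| ≤ r} · ∑_{i=0}^{rs} C(N, m+i)`,
  the bound "(4.1)" `Φ(C|_V) ≤ Size(C|_V) · binom(⌈2n/s⌉ + r, r) · binom(N, m + rs)` of the proof of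
  Thm. 8.10 in the tree's model (`Size(C|_V) ≤ Size(C)`; the two binomial factors in the printed
  shape via `GKKS.numSubsetsLE_le` and, for `m + rs ≤ N/2`, monotonicity of binomials).

Everything is proved (D-0026: no named facts).

## References

* M. Kumar, S. Saraf, *On the power of homogeneous depth 4 arithmetic circuits*, SIAM J. Comput.
  46 (2017) 336–387 (arXiv:1404.1950): §3, Lemma 4.1, Lemma 8.2, proof of Thm. 8.10 (eq. (4.1)).
-/

noncomputable section

open MvPolynomial

namespace Literature.Computability.AlgebraicComplexity.KumarSaraf

open GKKS ArithCircuit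

variable {K : Type*} [Field K] {σ : Type*}

/-! ### Merging low-degree factors -/

section Merge

/-- Greedy chunking of a list of factors (proof of Lemma 4.1): a factor of degree `≥ s/2` is a
chunk by itself; low-degree factors are accumulated until the accumulated degree reaches `s/2`.
The accumulator `acc` holds low-degree factors of total degree `< s/2`. [cite: KumarSaraf2017, Lemma 4.1] -/
def chunkAux (s : ℕ) : List (MvPolynomial σ K) → List (MvPolynomial σ K) →
    List (List (MvPolynomial σ K))
  | [], acc => [acc]
  | q :: t, acc =>
    if s ≤ 2 * q.totalDegree then [q] :: chunkAux s t acc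
    else if s ≤ 2 * ((q :: acc).map totalDegree).sum then (q :: acc) :: chunkAux s t []
    else chunkAux s t (q :: acc)

/-- Chunking only regroups: the chunks together are a permutation of the input.
[cite: KumarSaraf2017, Lemma 4.1] -/
theorem flatten_chunkAux_perm (s : ℕ) (t acc : List (MvPolynomial σ K)) :
    (chunkAux s t acc).flatten.Perm (t ++ acc) := by
  induction t generalizing acc with
  | nil => simp [chunkAux]
  | cons q t ih =>
    unfold chunkAux
    split_ifs with h1 h2
    · simpa using (ih acc)
    · simp only [List.flatten_cons, List.cons_append]
      refine List.Perm.cons q ?_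
      refine ((ih []).append_left acc).trans ?_
      rw [List.append_nil]
      exact List.perm_append_comm
    · exact (ih (q :: acc)).trans List.perm_middle

/-- There is always at least one chunk. [cite: KumarSaraf2017, Lemma 4.1] -/
theorem one_le_length_chunkAux (s : ℕ) (t acc : List (MvPolynomial σ K)) :
    1 ≤ (chunkAux s t acc).length := by
  induction t generalizing acc with
  | nil => simp [chunkAux]
  | cons q t ih =>
    unfold chunkAux
    split_ifs
    · simp
    · simp
    · exact ih _

/-- Every chunk is a single input factor or has total degree `< s`.
[cite: KumarSaraf2017, Lemma 4.1] -/
theorem mem_chunkAux (s : ℕ) (t acc : List (MvPolynomial σ K))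
    (hacc : 2 * (acc.map totalDegree).sum < s) {C : List (MvPolynomial σ K)}
    (hC : C ∈ chunkAux s t acc) : (∃ q ∈ t, C = [q]) ∨ (C.map totalDegree).sum < s := by
  induction t generalizing acc with
  | nil =>
    simp only [chunkAux, List.mem_singleton] at hC
    subst hC
    right; omega
  | cons q t ih =>
    unfold chunkAux at hC
    split_ifs at hC with h1 h2
    · rcases List.mem_cons.1 hC with rfl | hC
      · exact Or.inl ⟨q, by simp, rfl⟩
      · rcases ih acc hacc hC with ⟨q', hq', rfl⟩ | h
        · exact Or.inl ⟨q', by simp [hq'], rfl⟩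
        · exact Or.inr h
    · rcases List.mem_cons.1 hC with rfl | hC
      · right
        simp only [List.map_cons, List.sum_cons] at h2 ⊢
        omega
      · rcases ih [] (by simpa using Nat.pos_of_ne_zero (by omega)) hC with ⟨q', hq', rfl⟩ | h
        · exact Or.inl ⟨q', by simp [hq'], rfl⟩
        · exact Or.inr h
    · have hacc' : 2 * ((q :: acc).map totalDegree).sum < s := by omega
      rcases ih (q :: acc) hacc' hC with ⟨q', hq', rfl⟩ | h
      · exact Or.inl ⟨q', by simp [hq'], rfl⟩
      · exact Or.inr h

/-- All chunks but the last have total degree `≥ s/2`: counting bound.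
[cite: KumarSaraf2017, Lemma 4.1] -/
theorem length_chunkAux_bound (s : ℕ) (t acc : List (MvPolynomial σ K)) :
    s * ((chunkAux s t acc).length - 1) ≤
      2 * ((t.map totalDegree).sum + (acc.map totalDegree).sum) := by
  induction t generalizing acc with
  | nil => simp [chunkAux]
  | cons q t ih =>
    unfold chunkAux
    split_ifs with h1 h2
    · have hlen := one_le_length_chunkAux s t acc
      have := ih acc
      simp only [List.length_cons, List.map_cons, List.sum_cons]
      have e : s * (( chunkAux s t acc).length + 1 - 1) = s + s * ((chunkAux s t acc).length - 1) := by
        rw [Nat.add_sub_cancel]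
        conv_lhs => rw [show (chunkAux s t acc).length = ((chunkAux s t acc).length - 1) + 1 by omega]
        ring
      rw [e]
      omega
    · have hlen := one_le_length_chunkAux s t []
      have := ih []
      simp only [List.length_cons, List.map_cons, List.sum_cons, List.map_nil, List.sum_nil,
        add_zero] at this h2 ⊢
      have e : s * ((chunkAux s t []).length + 1 - 1) = s + s * ((chunkAux s t []).length - 1) := by
        rw [Nat.add_sub_cancel]
        conv_lhs => rw [show (chunkAux s t []).length = ((chunkAux s t []).length - 1) + 1 by omega]
        ring
      rw [e]
      omega
    · have := ih (q :: acc)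
      simp only [List.map_cons, List.sum_cons] at this ⊢
      omega

/-- **Merging (Kumar–Saraf 2017, proof of Lemma 4.1).** A list of factors of bottom support
`≤ s` (`s ≥ 1`) whose total degrees sum to at most `n` regroups into at most `2n/s + 1` factors of
bottom support `≤ s` with the same product ("at most one `i` such that degree of `P_i` is less than
`s/2` … `l ≤ ⌈2u/s⌉`"; a merged chunk has total degree `< s`, hence bottom support `< s`).
[cite: KumarSaraf2017, Lemma 4.1] -/
theorem exists_merge {s n : ℕ} (hs : 1 ≤ s) (L : List (MvPolynomial σ K))
    (hL : ∀ q ∈ L, SuppLE q s) (hdeg : (L.map totalDegree).sum ≤ n) :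
    ∃ L' : List (MvPolynomial σ K),
      L'.prod = L.prod ∧ (∀ q ∈ L', SuppLE q s) ∧ L'.length ≤ 2 * n / s + 1 := by
  refine ⟨(chunkAux s L []).map List.prod, ?_, ?_, ?_⟩
  · rw [← List.prod_flatten, (flatten_chunkAux_perm s L []).prod_eq, List.append_nil]
  · intro p hp
    obtain ⟨C, hC, rfl⟩ := List.mem_map.1 hp
    rcases mem_chunkAux s L [] (by simp only [List.map_nil, List.sum_nil, mul_zero]; omega) hC
      with ⟨q, hq, rfl⟩ | h
    · simpa using hL q hq
    · exact SuppLE.of_totalDegree_le ((totalDegree_list_prod C).trans (by omega))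
  · rw [List.length_map]
    have h1 := length_chunkAux_bound s L []
    simp only [List.map_nil, List.sum_nil, add_zero] at h1
    have h2 : (chunkAux s L []).length - 1 ≤ 2 * n / s := by
      rw [Nat.le_div_iff_mul_le (by omega)]
      calc ((chunkAux s L []).length - 1) * s = s * ((chunkAux s L []).length - 1) := by ring
        _ ≤ 2 * (L.map totalDegree).sum := h1
        _ ≤ 2 * n := by omega
    have h3 := one_le_length_chunkAux s L []
    omega

end Merge

/-! ### The circuit-side upper bound -/

section Circuit

variable [DecidableEq σ]

/-- The number of subsets of size `≤ r` is monotone in the ground set. [folklore] -/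
theorem numSubsetsLE_mono {l l' : ℕ} (h : l ≤ l') (r : ℕ) : numSubsetsLE l r ≤ numSubsetsLE l' r := by
  classical
  unfold numSubsetsLE
  refine Finset.card_le_card_of_injOn (fun A => A.map (Fin.castLEEmb h)) (fun A hA => ?_)
    (fun A _ B _ hAB => Finset.map_injective _ hAB)
  simp only [Finset.coe_filter, Finset.mem_univ, true_and, Set.mem_setOf_eq] at hA ⊢
  rwa [Finset.card_map]

/-- **`C|_V` is a `ΣΠΣΠ^{{s}}` circuit** (deterministic content of Kumar–Saraf 2017, Lemma 8.2):
if every bottom monomial of `P` all of whose variables lie in `V` has support `≤ s` (`s ≥ 1`),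
then every restricted bottom factor `Q_{ij}|_V` has bottom support `≤ s` (its monomials are
surviving bottom monomials, variables, or constants). [cite: KumarSaraf2017, Lemma 8.2] -/
theorem suppLE_restrictVars_of_isBottomFactor {P : ArithCircuit K σ} {q : MvPolynomial σ K}
    (hq : P.IsBottomFactor q) (V : Finset σ) {s : ℕ} (hs : 1 ≤ s)
    (hV : ∀ e ∈ P.monoExps, e.support ⊆ V → e.support.card ≤ s) :
    SuppLE (restrictVars V q) s := by
  intro β hβ
  obtain ⟨hβq, hβV⟩ := mem_support_restrictVars.1 hβ
  rcases hq β hβq with h | h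
  · exact hV β h hβV
  · exact (card_support_le_degree β).trans (h.trans hs)

omit [DecidableEq σ] in
/-- A product of a list of homogeneous polynomials is homogeneous of the sum of the degrees.
[folklore] -/
theorem isHomogeneous_list_prod (L : List (MvPolynomial σ K)) (d : MvPolynomial σ K → ℕ)
    (h : ∀ q ∈ L, (q : MvPolynomial σ K).IsHomogeneous (d q)) :
    L.prod.IsHomogeneous (L.map d).sum := by
  induction L with
  | nil => simpa using isHomogeneous_one σ K
  | cons q L ih =>
    rw [List.prod_cons, List.map_cons, List.sum_cons]
    exact (h q (by simp)).mul (ih fun p hp => h p (by simp [hp]))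

/-- **One product** (Kumar–Saraf 2017, Lemma 4.1 for one product gate of `C|_V`): if
`q = ∏ L ≠ 0` is homogeneous of degree `n`, its factors are homogeneous bottom factors of `P`, and
`V` is as in `suppLE_restrictVars_of_isBottomFactor`, then
`Φ_{ℳ,m}(q|_V) ≤ #{A ⊆ [2n/s+1] : |A| ≤ r} · ∑_{i=0}^{rs} C(N, m+i)`: restrict factor by factor,
merge the low-degree factors (`exists_merge`, `∑ deg = n`), apply `pspDim_prod_le`.
[cite: KumarSaraf2017, Lemma 4.1] -/
theorem pspDim_restrict_prod_le [Fintype σ] {P : ArithCircuit K σ} {q : MvPolynomial σ K} {n : ℕ}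
    (hq0 : q ≠ 0) (hqn : q.IsHomogeneous n) {L : List (MvPolynomial σ K)}
    (hL : ∀ g ∈ L, P.IsBottomFactor g ∧ ∃ e, g.IsHomogeneous e) (hqL : q = L.prod)
    (V : Finset σ) {s : ℕ} (hs : 1 ≤ s)
    (hV : ∀ e ∈ P.monoExps, e.support ⊆ V → e.support.card ≤ s)
    {ι : Type*} [Fintype ι] (Ls : ι → List σ) (r : ℕ) (hLs : ∀ i, (Ls i).length = r) (m : ℕ) :
    pspDim Ls m (restrictVars V q) ≤
      numSubsetsLE (2 * n / s + 1) r *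
        ∑ i ∈ Finset.range (r * s + 1), (Fintype.card σ).choose (m + i) := by
  classical
  -- degrees of the factors sum to `n`
  have hne : ∀ g ∈ L, g ≠ 0 := fun g hg h0 => hq0 (by rw [hqL]; exact List.prod_eq_zero (h0 ▸ hg))
  have hhom : ∀ g ∈ L, (g : MvPolynomial σ K).IsHomogeneous (totalDegree g) := fun g hg => by
    obtain ⟨e, he⟩ := (hL g hg).2
    rwa [he.totalDegree (hne g hg)]
  have hsum : (L.map totalDegree).sum = n := by
    have h1 := isHomogeneous_list_prod L totalDegree hhom
    rw [← hqL] at h1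
    exact h1.inj_right hqn hq0
  -- restrict factor by factor
  have hres : restrictVars V q = (L.map (restrictVars V)).prod := by rw [hqL, map_list_prod]
  have hL1 : ∀ p ∈ L.map (restrictVars V), SuppLE p s := by
    intro p hp
    obtain ⟨g, hg, rfl⟩ := List.mem_map.1 hp
    exact suppLE_restrictVars_of_isBottomFactor (hL g hg).1 V hs hV
  have hL2 : ((L.map (restrictVars V)).map totalDegree).sum ≤ n := by
    rw [← hsum, List.map_map]
    exact List.sum_le_sum fun g _ => totalDegree_restrictVars_le V g
  -- merge and apply Lemma 4.1
  obtain ⟨L', hprod, hL', hlen⟩ := exists_merge hs _ hL1 hL2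
  rw [hres, ← hprod, ← Fin.prod_univ_getElem L']
  calc pspDim Ls m (∏ j : Fin L'.length, L'[(j : ℕ)])
      ≤ numSubsetsLE L'.length r *
          ∑ i ∈ Finset.range (r * s + 1), (Fintype.card σ).choose (m + i) :=
        pspDim_prod_le Ls r hLs (fun j : Fin L'.length => L'[(j : ℕ)])
          (fun j => hL' _ (List.getElem_mem _)) m
    _ ≤ _ := Nat.mul_le_mul_right _ (numSubsetsLE_mono hlen r)

/-- **Kumar–Saraf 2017, Lemma 4.1 for the restricted circuit (eq. (4.1) of the proof of
Thm. 8.10), in the tree's model.** Let the homogeneous depth-4 circuit `P` compute `f`,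
homogeneous of degree `n ≥ 2`, and let `V` be a set of variables such that every bottom monomial
of `P` with all its variables in `V` has support `≤ s` (`s ≥ 1`; the event of Lemma 8.2, so that
`C|_V` is a `ΣΠΣΠ^{{s}}` circuit computing `f|_V`). Then for every family of order-`r` derivative
operators and every shift degree `m`,
`Φ_{ℳ,m}(f|_V) ≤ size(P) · #{A ⊆ [2n/s+1] : |A| ≤ r} · ∑_{i=0}^{rs} C(N, m+i)`
(normal form `exists_sum_prod`, sub-additivity, `pspDim_restrict_prod_le`).
[cite: KumarSaraf2017, Lemma 4.1 and Thm. 8.10 (4.1)] -/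
theorem pspDim_restrict_le [Fintype σ] {P : ArithCircuit K σ} {f : MvPolynomial σ K}
    (hc : P.Computes f) (h4 : P.IsDepthFour) (hh : P.IsHomogeneousCircuit) {n : ℕ}
    (hf : f.IsHomogeneous n) (hn : 2 ≤ n) (V : Finset σ) {s : ℕ} (hs : 1 ≤ s)
    (hV : ∀ e ∈ P.monoExps, e.support ⊆ V → e.support.card ≤ s)
    {ι : Type*} [Fintype ι] (Ls : ι → List σ) (r : ℕ) (hLs : ∀ i, (Ls i).length = r) (m : ℕ) :
    pspDim Ls m (restrictVars V f) ≤
      P.size * (numSubsetsLE (2 * n / s + 1) r *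
        ∑ i ∈ Finset.range (r * s + 1), (Fintype.card σ).choose (m + i)) := by
  classical
  obtain ⟨Q, c, hQ, hfQ, hprops⟩ := exists_sum_prod hc h4 hh hf hn
  set B := numSubsetsLE (2 * n / s + 1) r *
    ∑ i ∈ Finset.range (r * s + 1), (Fintype.card σ).choose (m + i) with hB
  have hres : restrictVars V f = ∑ q ∈ Q, c q • restrictVars V q := by
    rw [hfQ, map_sum]
    exact Finset.sum_congr rfl fun q _ => map_smul _ _ _
  rw [hres]
  calc pspDim Ls m (∑ q ∈ Q, c q • restrictVars V q)
      ≤ ∑ q ∈ Q, pspDim Ls m (restrictVars V q) := pspDim_sum_smul_le Ls m Q c _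
    _ ≤ ∑ _q ∈ Q, B := Finset.sum_le_sum fun q hq => by
        obtain ⟨hq0, hqn, L, hL, hqL⟩ := hprops q hq
        exact pspDim_restrict_prod_le hq0 hqn hL hqL V hs hV Ls r hLs m
    _ = Q.card * B := by rw [Finset.sum_const, smul_eq_mul]
    _ ≤ P.size * B := Nat.mul_le_mul_right B hQ

end Circuit

end Literature.Computability.AlgebraicComplexity.KumarSaraf

end
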